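import Mathlib
import Literature.NumberTheory.LFunctions.Zhang2022.Section7bStatements
import Literature.NumberTheory.LFunctions.Zhang2022.Section5Lemma54DeltaDeriv
import Literature.Analysis.Complex.CahenMellinSector
import HarnessLib

/-!
# Zhang (2022) §7, proof of Proposition 7.1, toward `Z22:§7.u022`: the kernel `x^{−s}ϑ*(1−s)ω(s)`
# on the line `σ = 3/2` and the absolute convergence of the `m`-series

Topic `Literature/NumberTheory/LFunctions/Zhang2022` (Landau–Siegel adjudication tree;
verdict-neutral). Y. Zhang, *Discrete mean estimates and the Landau–Siegel zero*,
arXiv:2211.02515v1 (2022) [Zhang2022LandauSiegel], §7 p. 35, tex L1920–L1924 ("integration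
term-by-term", DAG node `Z22:§7.u022`, inside the proof node of Proposition 7.1). The companion
file `Section7I1Termwise.lean` proves `I1line = I1termwise` by Fubini–Tonelli on the line
`s = 3/2 + it`; this file supplies its three analytic inputs:

* `Section7I1Kernel.exists_kernel_bound` — `‖x^{−s}ϑ*(1−s)‖ ≤ K(1+|t|)^N x^{−3/2}` for `x > 0`
  (`x^{−s}ϑ*(1−s) = Γ(s)(2πix)^{−s}`, tree `Lemma53.cpow_neg_mul_varthetaStar_eq`, with the tree's
  Stirling-type bound `exists_norm_Gamma_vertical_le` and `|(2πix)^{−s}| = (2πx)^{−3/2}e^{πt/2}`),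
  continuity (`continuous_kernel`, `continuous_varthetaStar`), and the Gaussian weight:
  `norm_omega_line_le` (`Lemma53.norm_omega_vertical`), `integrable_majorant`;
* `Section7I1Kernel.LSeriesSummable_coeff` — `Σ_m (κ∗a₁)(m)ψ(m)m^{−s}` converges absolutely on
  `σ > 1` for bounded `𝐚₁` (`κ = n^{−β₁}∗n^{−β₂}∗n^{−β₃}∗μ`, Mathlib's `LSeriesSummable.convolution`;
  the source: "(κ∗a₁)(m) = O(τ₅(m))", tex L1903);
* `Section7I1Kernel.cpow_bookkeeping` — `p^{s−1}n^{−(1−s)}/m^{s} = (m/(pn))^{−s}/(pn)`.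

No new definitions, no new named facts; nothing here bears on Theorems 1–2 of the source or on the
cell's verdict on (8.24).

## References

* Y. Zhang, arXiv:2211.02515v1 (2022), §7 p. 35, tex L1903, L1920–L1924; (2.15), (5.5)–(5.6).
  [cite: Zhang2022LandauSiegel, §7 p.35 tex L1921]
* E. C. Titchmarsh, *The Theory of the Riemann Zeta-Function*, 2nd ed., OUP 1986, §2.15, §4.12.
  [cite: Titchmarsh1986, §4.12]
-/

noncomputable section

open Complex Real MeasureTheory Filter Topology Set
open scoped LSeries.notation

namespace Literature.NumberTheory.LFunctions.Zhang2022.Section7I1Kernel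

open Literature.NumberTheory.LFunctions.Zhang2022.Section7bStatements
open Literature.NumberTheory.LFunctions.Zhang2022.Skeleton

/-! ## §1. The kernel `x^{−s}ϑ*(1−s)` and the weight `ω(s)` on the line `s = 3/2 + it` -/

/-- `x^{−s}ϑ*(1−s) = Γ(s)(2πix)^{−s}` on the line, `x > 0` (the tree's Cahen–Mellin form).
[cite: Zhang2022LandauSiegel, §5 (5.5)–(5.6)] -/
theorem kernel_eq_Gamma {y : ℝ} (hy : 0 < y) (t : ℝ) :
    ((y : ℝ) : ℂ) ^ (-((3 / 2 : ℂ) + t * I)) * GammaFactor.varthetaStarOneSub ((3 / 2 : ℂ) + t * I) =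
      Complex.Gamma ((3 / 2 : ℂ) + t * I) * (((2 * π * y : ℝ) : ℂ) * I) ^ (-((3 / 2 : ℂ) + t * I)) :=
  Lemma53.cpow_neg_mul_varthetaStar_eq hy _

/-- `ϑ*(1−s) = Γ(s)(2πi)^{−s}` on the line (the case `x = 1`). [cite: Zhang2022LandauSiegel, §5 (5.5)] -/
theorem varthetaStar_eq_Gamma (t : ℝ) :
    GammaFactor.varthetaStarOneSub ((3 / 2 : ℂ) + t * I) =
      Complex.Gamma ((3 / 2 : ℂ) + t * I) * (((2 * π * 1 : ℝ) : ℂ) * I) ^ (-((3 / 2 : ℂ) + t * I)) := by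
  have h := kernel_eq_Gamma one_pos t
  rwa [Complex.ofReal_one, Complex.one_cpow, one_mul] at h

/-- The cast `((3/2 : ℝ) : ℂ) = 3/2`. [folklore] -/
private theorem cast_three_halves : ((3 / 2 : ℝ) : ℂ) = 3 / 2 := by norm_num

/-- On the line `s = 3/2 + it`: the exponent `−(1−s)` is never `0`. [cite: Zhang2022LandauSiegel, §7 p.35 tex L1920] -/
theorem neg_one_sub_ne_zero (t : ℝ) : (-(1 - ((3 / 2 : ℂ) + t * I))) ≠ 0 := by
  intro h
  have := congrArg Complex.re h
  norm_num at this

/-- On the line `s = 3/2 + it`: `s ≠ 0`. [cite: Zhang2022LandauSiegel, §7 p.35 tex L1920] -/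
theorem three_halves_add_ne_zero (t : ℝ) : ((3 / 2 : ℂ) + t * I) ≠ 0 := by
  intro h
  have := congrArg Complex.re h
  norm_num at this

/-- `(2πyi) ≠ 0` for `y > 0`. [folklore] -/
private theorem two_pi_mul_I_ne_zero {y : ℝ} (hy : 0 < y) : ((2 * π * y : ℝ) : ℂ) * I ≠ 0 :=
  mul_ne_zero (ofReal_ne_zero.mpr (by positivity : (0 : ℝ) < 2 * π * y).ne') I_ne_zero

/-- Continuity of `t ↦ x^{−s}ϑ*(1−s)` (`s = 3/2 + it`, `x > 0`). [folklore] -/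
private theorem continuous_kernel {y : ℝ} (hy : 0 < y) :
    Continuous fun t : ℝ =>
      ((y : ℝ) : ℂ) ^ (-((3 / 2 : ℂ) + t * I)) * GammaFactor.varthetaStarOneSub ((3 / 2 : ℂ) + t * I) := by
  simp_rw [kernel_eq_Gamma hy]
  have h := Literature.Analysis.Complex.continuous_Gamma_mul_cpow_neg (c := (3 / 2 : ℝ))
    (by norm_num) (two_pi_mul_I_ne_zero hy)
  simp only [cast_three_halves] at h
  exact h

/-- Continuity of `t ↦ ϑ*(1−s)` on the line `s = 3/2 + it` ((5.5)). [cite: Zhang2022LandauSiegel, §5 (5.5)] -/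
theorem continuous_varthetaStar :
    Continuous fun t : ℝ => GammaFactor.varthetaStarOneSub ((3 / 2 : ℂ) + t * I) := by
  have h := continuous_kernel one_pos
  simp_rw [Complex.ofReal_one, Complex.one_cpow, one_mul] at h
  exact h

/-- **Stirling on the line**: there are `K, N ≥ 0` with
`‖x^{−s}ϑ*(1−s)‖ ≤ K(1+|t|)^N x^{−3/2}` for all `x > 0`, `s = 3/2 + it` (from
`|Γ(3/2+it)| ≤ K(1+|t|)^N e^{−π|t|/2}` and `|(2πix)^{−s}| = (2πx)^{−3/2}e^{πt/2}`).
[cite: Titchmarsh1986, §4.12] -/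
theorem exists_kernel_bound :
    ∃ K N : ℝ, 0 ≤ K ∧ 0 ≤ N ∧ ∀ y : ℝ, 0 < y → ∀ t : ℝ,
      ‖((y : ℝ) : ℂ) ^ (-((3 / 2 : ℂ) + t * I)) * GammaFactor.varthetaStarOneSub ((3 / 2 : ℂ) + t * I)‖ ≤
        K * (1 + |t|) ^ N * y ^ (-(3 / 2 : ℝ)) := by
  obtain ⟨K, N, hK, hN, hΓ⟩ :=
    Literature.Analysis.Complex.exists_norm_Gamma_vertical_le (c := (3 / 2 : ℝ)) (by norm_num)
  refine ⟨K, N, hK, hN, fun y hy t => ?_⟩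
  have hz := two_pi_mul_I_ne_zero hy
  rw [kernel_eq_Gamma hy, norm_mul]
  have h1 := hΓ t
  rw [cast_three_halves] at h1
  have h2 := Literature.Analysis.Complex.norm_cpow_neg_add_mul_I_of_ne_zero hz (3 / 2) t
  rw [cast_three_halves] at h2
  have harg : arg (((2 * π * y : ℝ) : ℂ) * I) = π / 2 := by
    rw [Complex.arg_real_mul _ (by positivity : (0 : ℝ) < 2 * π * y), Complex.arg_I]
  have hnz : ‖((2 * π * y : ℝ) : ℂ) * I‖ = 2 * π * y := by
    rw [norm_mul, Complex.norm_real, Complex.norm_I, mul_one, Real.norm_of_nonneg (by positivity)]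
  rw [h2, harg, hnz]
  have hexp : Real.exp (-(π / 2 * |t|)) * Real.exp (t * (π / 2)) ≤ 1 := by
    rw [← Real.exp_add]
    apply Real.exp_le_one_iff.mpr
    have : t ≤ |t| := le_abs_self t
    nlinarith [Real.pi_pos]
  have hrpow : (2 * π * y) ^ (-(3 / 2 : ℝ)) ≤ y ^ (-(3 / 2 : ℝ)) :=
    Real.rpow_le_rpow_of_nonpos hy (by nlinarith [Real.pi_gt_three]) (by norm_num)
  have hpoly : 0 ≤ K * (1 + |t|) ^ N := by positivity
  have hy32 : 0 ≤ (2 * π * y) ^ (-(3 / 2 : ℝ)) := Real.rpow_nonneg (by positivity) _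
  calc ‖Complex.Gamma (3 / 2 + t * I)‖ * ((2 * π * y) ^ (-(3 / 2 : ℝ)) * Real.exp (t * (π / 2)))
      ≤ (K * (1 + |t|) ^ N * Real.exp (-(π / 2 * |t|))) *
          ((2 * π * y) ^ (-(3 / 2 : ℝ)) * Real.exp (t * (π / 2))) :=
        mul_le_mul_of_nonneg_right h1 (by positivity)
    _ = K * (1 + |t|) ^ N * (2 * π * y) ^ (-(3 / 2 : ℝ)) *
          (Real.exp (-(π / 2 * |t|)) * Real.exp (t * (π / 2))) := by ring
    _ ≤ K * (1 + |t|) ^ N * (2 * π * y) ^ (-(3 / 2 : ℝ)) * 1 := by gcongr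
    _ ≤ K * (1 + |t|) ^ N * y ^ (-(3 / 2 : ℝ)) := by rw [mul_one]; gcongr

/-- Continuity of `t ↦ ω(3/2+it)` ((2.15)). [cite: Zhang2022LandauSiegel, §2 (2.15)] -/
theorem continuous_omega_line (D : ℕ) :
    Continuous fun t : ℝ => omegaW D ((3 / 2 : ℂ) + t * I) := by
  unfold omegaW SmoothWeight.omega SmoothWeight.s0
  fun_prop

/-- `‖ω(3/2+it)‖ ≤ (√π/𝓛₂)e^{1/(4𝓛₂²)}·e^{−(t−2πt₀)²/(4𝓛₂²)}` (indeed equality).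
[cite: Zhang2022LandauSiegel, §2 (2.15)] -/
theorem norm_omega_line_le {D : ℕ} (hL : 0 < ell2 D) (t : ℝ) :
    ‖omegaW D ((3 / 2 : ℂ) + t * I)‖ ≤
      (Real.sqrt π / ell2 D * Real.exp (1 / (4 * ell2 D ^ 2))) *
        Real.exp (-((t - 2 * π * t0 D) ^ 2) / (4 * ell2 D ^ 2)) := by
  have h := Lemma53.norm_omega_vertical hL (t0 D) (3 / 2) t
  rw [cast_three_halves] at h
  unfold omegaW
  have hsplit : Real.exp (((3 / 2 - 1 / 2) ^ 2 - (t - 2 * π * t0 D) ^ 2) / (4 * ell2 D ^ 2)) =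
      Real.exp (1 / (4 * ell2 D ^ 2)) * Real.exp (-((t - 2 * π * t0 D) ^ 2) / (4 * ell2 D ^ 2)) := by
    rw [← Real.exp_add]
    congr 1
    ring
  rw [h, hsplit]
  exact le_of_eq (by ring)

/-- `(1 + |t|)^N ≤ e^{N|t|}` for `N ≥ 0`. [folklore] -/
private theorem one_add_abs_rpow_le (t : ℝ) {N : ℝ} (hN : 0 ≤ N) :
    (1 + |t|) ^ N ≤ Real.exp (N * |t|) := by
  have h1 : 1 + |t| ≤ Real.exp |t| := by
    have := Real.add_one_le_exp |t|; linarith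
  calc (1 + |t|) ^ N ≤ (Real.exp |t|) ^ N := Real.rpow_le_rpow (by positivity) h1 hN
    _ = Real.exp (N * |t|) := by rw [← Real.exp_mul, mul_comm]

/-- `t ↦ e^{N|t|}·e^{−(t−a)²/(4L₂²)}` is integrable (`L₂ > 0`). [folklore] -/
private theorem integrable_exp_abs_mul_gaussian {L₂ : ℝ} (hL : 0 < L₂) (N a : ℝ) :
    Integrable fun t : ℝ => Real.exp (N * |t|) * Real.exp (-((t - a) ^ 2) / (4 * L₂ ^ 2)) := by
  have hL' : 1 / (2 * L₂) ≠ 0 := by positivity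
  have key : ∀ σ : ℝ, Integrable fun t : ℝ =>
      Real.exp (σ * t) * Real.exp (-((t - a) ^ 2) / (4 * L₂ ^ 2)) := by
    intro σ
    have h := (Lemma53.integrable_exp_lin_sub_sq hL' (σ + a / (2 * L₂ ^ 2))).const_mul
      (Real.exp (-(a ^ 2) / (4 * L₂ ^ 2)))
    refine h.congr (Eventually.of_forall fun t => ?_)
    simp only
    rw [← Real.exp_add, ← Real.exp_add]
    congr 1
    field_simp
    ring
  refine ((key N).add (key (-N))).mono' (by fun_prop) (Eventually.of_forall fun t => ?_)
  have hpos : 0 ≤ Real.exp (N * |t|) * Real.exp (-((t - a) ^ 2) / (4 * L₂ ^ 2)) := by positivity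
  rw [Real.norm_of_nonneg hpos, Pi.add_apply, ← add_mul]
  gcongr
  rcases le_or_gt 0 t with ht | ht
  · rw [abs_of_nonneg ht]; linarith [Real.exp_pos (-N * t)]
  · rw [abs_of_neg ht, show N * -t = -N * t by ring]; linarith [Real.exp_pos (N * t)]

/-- The majorant `(1+|t|)^N e^{−(t−a)²/(4L₂²)}` of `|ϑ*(1−s)ω(s)|` on the line is integrable
(polynomial growth against the Gaussian of (2.15)). [cite: Zhang2022LandauSiegel, §2 (2.15)] -/
theorem integrable_majorant {L₂ : ℝ} (hL : 0 < L₂) {N : ℝ} (hN : 0 ≤ N) (a : ℝ) :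
    Integrable fun t : ℝ => (1 + |t|) ^ N * Real.exp (-((t - a) ^ 2) / (4 * L₂ ^ 2)) := by
  refine (integrable_exp_abs_mul_gaussian hL N a).mono' ?_ (Eventually.of_forall fun t => ?_)
  · have hc : Continuous fun t : ℝ => (1 + |t|) ^ N :=
      Continuous.rpow_const (by fun_prop) fun t => Or.inl (by positivity)
    exact (hc.mul (by fun_prop)).aestronglyMeasurable
  · have h0 : 0 ≤ (1 + |t|) ^ N * Real.exp (-((t - a) ^ 2) / (4 * L₂ ^ 2)) := by positivity
    rw [Real.norm_of_nonneg h0]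
    exact mul_le_mul_of_nonneg_right (one_add_abs_rpow_le t hN) (Real.exp_pos _).le

/-! ## §2. Absolute convergence of `Σ_m (κ∗a₁)(m)ψ(m)m^{−s}` at `σ = 3/2` -/

/-- The `κ` of §7 has an absolutely convergent L-series on `σ > 1` (`κ = n^{−β₁}∗n^{−β₂}∗n^{−β₃}∗μ`,
each factor bounded by `1`). [cite: Zhang2022LandauSiegel, §7 p. 34, tex L1865] -/
theorem LSeriesSummable_kappaZ (c' : ℝ) (D : ℕ) {s : ℂ} (hs : 1 < s.re) :
    LSeriesSummable (fun n => kappaZ c' D n) s := by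
  have hI : ∀ b : ℝ, LSeriesSummable (fun n => MeanSquareMajorant.powI b n) s := fun b =>
    LSeriesSummable_of_bounded_of_one_lt_re (m := 1)
      (fun n hn => (MeanSquareMajorant.norm_powI_of_pos b (Nat.pos_of_ne_zero hn)).le) hs
  have hμ : LSeriesSummable
      (fun n => (ArithmeticFunction.moebius : ArithmeticFunction ℂ) n) s :=
    LSeriesSummable_of_bounded_of_one_lt_re (m := 1)
      (fun n _ => Literature.NumberTheory.LFunctions.norm_moebius_complex_le_one n) hs
  have h := ArithmeticFunction.LSeriesSummable_mul
    (ArithmeticFunction.LSeriesSummable_mul (ArithmeticFunction.LSeriesSummable_mul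
      (hI (b1 c' D)) (hI (b2 c' D))) (hI (b3 c' D))) hμ
  exact h

/-- **Absolute convergence on `σ > 1` of the `m`-series** `Σ_m (κ∗a₁)(m)ψ(m)m^{−s}` for bounded
`𝐚₁` (the source: "(κ∗a₁)(m) = O(τ₅(m))", tex L1903). [cite: Zhang2022LandauSiegel, §7 p. 35, tex L1903] -/
theorem LSeriesSummable_coeff (c' : ℝ) {D : ℕ} (x : Chr D) {B : ℝ} {a₁ : ℕ → ℂ}
    (ha₁ : ∀ n, ‖a₁ n‖ ≤ B) {s : ℂ} (hs : 1 < s.re) :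
    LSeriesSummable (fun m => kappaConv c' D a₁ m * x.ψ (m : ZMod x.p)) s := by
  have ha : LSeriesSummable a₁ s := LSeriesSummable_of_bounded_of_one_lt_re (fun n _ => ha₁ n) hs
  have hκa : LSeriesSummable (kappaConv c' D a₁) s := (LSeriesSummable_kappaZ c' D hs).convolution ha
  refine Summable.of_norm_bounded hκa.norm fun m => LSeries.norm_term_le s ?_
  calc ‖kappaConv c' D a₁ m * x.ψ (m : ZMod x.p)‖
      = ‖kappaConv c' D a₁ m‖ * ‖x.ψ (m : ZMod x.p)‖ := norm_mul _ _
    _ ≤ ‖kappaConv c' D a₁ m‖ * 1 := by gcongr; exact x.ψ.norm_le_one _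
    _ = ‖kappaConv c' D a₁ m‖ := mul_one _

/-! ## §3. The exponent bookkeeping `τ(ψ̄)p^{s−1}m^{−s}n^{−(1−s)} = (τ(ψ̄)/p)n⁻¹(m/(pn))^{−s}` -/

/-- **The exponent bookkeeping of tex L1921**: `p^{s−1}·n^{−(1−s)}/m^{s} = (m/(pn))^{−s}/(pn)`
for positive integers `p, m, n` and any `s` (how `τ(ψ̄)p^{s−1}Σ_mΣ_n … m^{−s}n^{−(1−s)}` becomes
`(τ(ψ̄)/p)Σ_mΣ_n … n⁻¹(m/(pn))^{−s}`). [cite: Zhang2022LandauSiegel, §7 p.35 tex L1921] -/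
theorem cpow_bookkeeping {p m n : ℕ} (hp : 0 < p) (hm : 0 < m) (hn : 0 < n) (s : ℂ) :
    (p : ℂ) ^ (s - 1) * (n : ℂ) ^ (-(1 - s)) / (m : ℂ) ^ s =
      ((((m : ℝ) / ((p : ℝ) * n)) : ℝ) : ℂ) ^ (-s) / ((p : ℂ) * n) := by
  have hp' : (p : ℂ) ≠ 0 := Nat.cast_ne_zero.mpr hp.ne'
  have hm' : (m : ℂ) ≠ 0 := Nat.cast_ne_zero.mpr hm.ne'
  have hn' : (n : ℂ) ≠ 0 := Nat.cast_ne_zero.mpr hn.ne'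
  have hy0 : (0 : ℝ) < (m : ℝ) / ((p : ℝ) * n) := by positivity
  have hy' : ((((m : ℝ) / ((p : ℝ) * n)) : ℝ) : ℂ) ≠ 0 := ofReal_ne_zero.mpr hy0.ne'
  have lp : Complex.log (p : ℂ) = ((Real.log p : ℝ) : ℂ) := Complex.natCast_log.symm
  have lm : Complex.log (m : ℂ) = ((Real.log m : ℝ) : ℂ) := Complex.natCast_log.symm
  have ln : Complex.log (n : ℂ) = ((Real.log n : ℝ) : ℂ) := Complex.natCast_log.symm
  have ly : Complex.log ((((m : ℝ) / ((p : ℝ) * n)) : ℝ) : ℂ) =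
      ((Real.log m - Real.log p - Real.log n : ℝ) : ℂ) := by
    rw [← Complex.ofReal_log hy0.le, Real.log_div (by positivity) (by positivity),
      Real.log_mul (by positivity) (by positivity)]
    push_cast
    ring
  have ep : (p : ℂ) = Complex.exp ((Real.log p : ℝ) : ℂ) := by rw [← lp, Complex.exp_log hp']
  have en : (n : ℂ) = Complex.exp ((Real.log n : ℝ) : ℂ) := by rw [← ln, Complex.exp_log hn']
  rw [Complex.cpow_def_of_ne_zero hp', Complex.cpow_def_of_ne_zero hn',
    Complex.cpow_def_of_ne_zero hm', Complex.cpow_def_of_ne_zero hy', lp, lm, ln, ly]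
  conv_rhs => rw [ep, en]
  simp only [← Complex.exp_add, ← Complex.exp_sub]
  congr 1
  push_cast
  ring

end Literature.NumberTheory.LFunctions.Zhang2022.Section7I1Kernel
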